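import Summits.QuantumFields.YangMills.Theorems.ColdStartUniversalityLatticeLangevinLiebRobinsonCarreOfLipschitz
import Summits.QuantumFields.YangMills.Theorems.ColdStartUniversalityLatticeLangevinLiebRobinsonLightCone
import HarnessLib

/-!
# Route `ColdStartUniversality` (fixed-cut-off SZZ dynamics; LIEB–ROBINSON / LOCALITY package, file 24):
# ★★ THE JOINT SPACE-TIME PROFILE OF `κ_t F` — locality WITH decay by interpolating the light cone and the gradient bound

Helper file (seat `ym-line-csu-p1`, g31; `--supports stmt-QuantumFields-24809`).  Memo-g30 §3 item 2 asked for «locality with decay»: a per-link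
Lipschitz bound on `κ_t F` that decays BOTH away from the support of `F` and in time.  A per-link `Γ₂` calculus is not available; but the two bounds
the tree has — the Lieb–Robinson profile (growth `e^(λt)`, spatial decay `108^(−D)`, every coupling; g30) and the curvature profile (decay `e^(−ρt)`,
no spatial information; `|β'| < 1/12`, g29 gradient bound + one-link oscillation) — can be interpolated:
* ★★ `transitionKernel_linkLipschitz_spacetime_profile` — at `|β'| < 1/12`, for a `C⁵` cylinder observable with link-Lipschitz profile `ℓ`, the
  Lipschitz constant of `κ_t(f∘coords)` in the link `e₀` is `≤ min(e^(λt)·Σ_e ℓ_e 108^(−D(e,e₀)), √2π·e^(−ρt)·√(Σ_e ℓ_e²))`;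
* ★★ `transitionKernel_linkLipschitz_interpolated_profile` — hence `≤ (e^(λt)·Σ_e ℓ_e 108^(−D(e,e₀)))^(1−θ)·(√2π·e^(−ρt)·√(Σℓ²))^θ` for every
  `θ ∈ [0,1]`: for `θ > λ/(λ+ρ)` this decays exponentially in `t` at rate `θρ − (1−θ)λ` AND in the distance at rate `(1−θ)·log 108`.
THEOREMS ONLY, no definition, no sorry; [folklore].  HONEST FRAMING: fixed cut-off, FIXED `|β'| < 1/12` for the decay half; an interpolation, not the
per-link Bakry–Émery bound; nothing `K`-uniform; `UniformColdStartMixing` (24809) is NOT restated; no crux, rung or summit statement is proved; the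
Yang–Mills mass gap is NOT proved.
-/

set_option autoImplicit false

noncomputable section

namespace Summit.QuantumFields.YangMills.Theorems.ColdStartUniversality.LiebRobinson

open MeasureTheory ProbabilityTheory Matrix Complex Finset Filter Set Metric
open scoped ComplexConjugate BigOperators Matrix NNReal ENNReal Topology
open Literature.Probability.Process Literature.MathematicalPhysics.QuantumFieldTheory
open Literature.MathematicalPhysics.QuantumFieldTheory.Balaban1983to89
open Literature.MathematicalPhysics.QuantumLattice (fundamentalRep fundamentalLatticeRep continuous_fundamentalRep fundamentalRep_apply)

variable {L : ℕ} [NeZero L]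

/-- ★★ **Joint space-time profile of `κ_t F`.**  At `|β'| < 1/12`, every `L`, every realising kernel family: if `f` is `C⁵` and `f∘coords` has a
link-Lipschitz profile `ℓ ≥ 0`, then for every link `e₀`, every `t` and all starts `y, y'` differing only at `e₀`:
`|κ_t(f∘coords)(y) − κ_t(f∘coords)(y')| ≤ min(e^(λt)·Σ_e ℓ_e·108^(−D(e,e₀)), √2π·e^(−ρt)·√(Σ_e ℓ_e²))·‖y_(e₀) − y'_(e₀)‖_F`,
`λ = (1300+4√2)|β'|`, `ρ = 1 − 12|β'|` (light cone: `transitionKernel_linkLipschitz_profile`; decay: `carre_le_of_linkLipschitz` + `wilson_lipschitz_contraction_uniform`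
+ `oscillation_oneLink_le_of_carre_le`). [folklore] -/
theorem transitionKernel_linkLipschitz_spacetime_profile (L : ℕ) [NeZero L] (β' : ℝ) (hβ : |β'| < 1 / 12)
    (κ : ℝ≥0 → Kernel (GaugeConfig 3 L (Matrix.specialUnitaryGroup (Fin 2) ℂ))
      (GaugeConfig 3 L (Matrix.specialUnitaryGroup (Fin 2) ℂ))) [∀ t, IsMarkovKernel (κ t)]
    (hreal : ∀ (t : ℝ≥0) (x : GaugeConfig 3 L (Matrix.specialUnitaryGroup (Fin 2) ℂ))
        (Ω : Type) [MeasurableSpace Ω] (P : Measure Ω) [IsProbabilityMeasure P]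
        (W : ℝ≥0 → Ω → (Edge 3 L × NoiseIdx 2 → ℝ)) (hW : IsFlatBrownian W P)
        (U : ℝ≥0 → Ω → GaugeConfig 3 L (Matrix.specialUnitaryGroup (Fin 2) ℂ)),
        (∀ ω, U 0 ω = x) →
        (latticeLangevinDynamics (fundamentalLatticeRep 2) β').IsSolution (fundamentalRep (Fin 2))
          hW.natFiltration P W U →
        κ t x = P.map (U t))
    {f : (Edge 3 L × Fin 2 × Fin 2 × Bool → ℝ) → ℝ} (hf : ContDiff ℝ 5 f) {ℓ : Edge 3 L → ℝ} (hℓ : ∀ e, 0 ≤ ℓ e)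
    (t : ℝ≥0) (e₀ : Edge 3 L) (y y' : GaugeConfig 3 L (Matrix.specialUnitaryGroup (Fin 2) ℂ)) (hyy' : ∀ e, e ≠ e₀ → y e = y' e) :
    let coords : GaugeConfig 3 L (Matrix.specialUnitaryGroup (Fin 2) ℂ) → (Edge 3 L × Fin 2 × Fin 2 × Bool → ℝ) :=
      fun V q => (fun z : ℂ => if q.2.2.2 then z.im else z.re)
        ((fundamentalRep (Fin 2) (V q.1) : Matrix (Fin 2) (Fin 2) ℂ) q.2.1 q.2.2.1)
    (∀ (e : Edge 3 L) (y y' : (GaugeConfig 3 L (Matrix.specialUnitaryGroup (Fin 2) ℂ))), (∀ f', f' ≠ e → y f' = y' f') →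
      |f (coords y) - f (coords y')| ≤ ℓ e * frobNorm ((y e : Matrix (Fin 2) (Fin 2) ℂ) - (y' e : Matrix (Fin 2) (Fin 2) ℂ))) →
    |(∫ z, f (coords z) ∂(κ t y)) - ∫ z, f (coords z) ∂(κ t y')| ≤
      min (Real.exp ((1300 + 4 * Real.sqrt 2) * |β'| * (t : ℝ)) * ∑ e : Edge 3 L, ℓ e * ((108 : ℝ)⁻¹) ^ (Finset.univ.sup fun i : Fin 3 => ((e.1 i - e₀.1 i).valMinAbs).natAbs)) (Real.sqrt 2 * Real.pi * Real.exp (-((1 - 12 * |β'|) * (t : ℝ))) * Real.sqrt (∑ e : Edge 3 L, ℓ e ^ 2)) * frobNorm ((y e₀ : Matrix (Fin 2) (Fin 2) ℂ) - (y' e₀ : Matrix (Fin 2) (Fin 2) ℂ)) := by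
  intro coords hLip
  classical
  have hco : Continuous coords := continuous_coords (L := L)
  have hFc : Continuous fun V => f (coords V) := hf.continuous.comp hco
  have hd : 0 ≤ frobNorm ((y e₀ : Matrix (Fin 2) (Fin 2) ℂ) - (y' e₀ : Matrix (Fin 2) (Fin 2) ℂ)) := frobNorm_nonneg _
  -- light cone
  have hLR : |(∫ z, f (coords z) ∂(κ t y)) - ∫ z, f (coords z) ∂(κ t y')| ≤ (Real.exp ((1300 + 4 * Real.sqrt 2) * |β'| * (t : ℝ)) * ∑ e : Edge 3 L, ℓ e * ((108 : ℝ)⁻¹) ^ (Finset.univ.sup fun i : Fin 3 => ((e.1 i - e₀.1 i).valMinAbs).natAbs)) * frobNorm ((y e₀ : Matrix (Fin 2) (Fin 2) ℂ) - (y' e₀ : Matrix (Fin 2) (Fin 2) ℂ)) := by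
    have h := transitionKernel_linkLipschitz_profile L β' κ hreal hFc hℓ hLip t e₀ y y' hyy'
    have hlam : |β'| * (4 + 4 * Real.sqrt 2 + 12 * 108) = (1300 + 4 * Real.sqrt 2) * |β'| := by ring
    rw [hlam] at h
    exact h
  -- curvature
  have hcurv : |(∫ z, f (coords z) ∂(κ t y)) - ∫ z, f (coords z) ∂(κ t y')| ≤ (Real.sqrt 2 * Real.pi * Real.exp (-((1 - 12 * |β'|) * (t : ℝ))) * Real.sqrt (∑ e : Edge 3 L, ℓ e ^ 2)) * frobNorm ((y e₀ : Matrix (Fin 2) (Fin 2) ℂ) - (y' e₀ : Matrix (Fin 2) (Fin 2) ℂ)) := by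
    set S : ℝ := Real.sqrt (∑ e : Edge 3 L, ℓ e ^ 2) with hS
    have hS0 : 0 ≤ S := Real.sqrt_nonneg _
    have h16 : (4 * S) ^ 2 = 16 * ∑ e : Edge 3 L, ℓ e ^ 2 := by
      rw [mul_pow, hS, Real.sq_sqrt (Finset.sum_nonneg fun e _ => sq_nonneg (ℓ e))]; norm_num
    obtain ⟨g, hg, -, hgrep, hbound⟩ := wilson_lipschitz_contraction_uniform L β' hβ κ hreal hf (σ2 := (4 * S) ^ 2) t
      (fun V => by rw [h16]; exact carre_le_of_linkLipschitz L β' (hf.of_le (by norm_num)) hℓ V hLip)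
    set σt : ℝ := Real.exp (-((1 - 12 * |β'|) * (t : ℝ))) * (4 * S) with hσt
    have hσt0 : 0 ≤ σt := by rw [hσt]; positivity
    have he : Real.exp (-(2 * (1 - 12 * |β'|) * (t : ℝ))) * (4 * S) ^ 2 = σt ^ 2 := by
      have h2 : Real.exp (-(2 * (1 - 12 * |β'|) * (t : ℝ))) = Real.exp (-((1 - 12 * |β'|) * (t : ℝ))) ^ 2 := by
        rw [← Real.exp_nat_mul]; congr 1; push_cast; ring
      rw [h2, hσt]; ring
    have hΓg := fun V : GaugeConfig 3 L (Matrix.specialUnitaryGroup (Fin 2) ℂ) => (hbound V).trans (le_of_eq he)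
    have hosc := oscillation_oneLink_le_of_carre_le L β' (hg.of_le (by norm_num)) hσt0 e₀ hΓg y' y (fun e he => hyy' e he)
    rw [← hgrep y, ← hgrep y'] at hosc
    refine hosc.trans (le_of_eq ?_)
    rw [hσt]
    have hc : Real.pi / (2 * Real.sqrt 2) * (Real.exp (-((1 - 12 * |β'|) * (t : ℝ))) * (4 * S)) =
        Real.sqrt 2 * Real.pi * Real.exp (-((1 - 12 * |β'|) * (t : ℝ))) * S := by
      have hs : Real.sqrt 2 * Real.sqrt 2 = 2 := Real.mul_self_sqrt (by norm_num)
      have h2 : (2 * Real.sqrt 2 : ℝ) ≠ 0 := by positivity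
      field_simp
      nlinarith [hs]
    rw [hc]
  rcases le_total (Real.exp ((1300 + 4 * Real.sqrt 2) * |β'| * (t : ℝ)) * ∑ e : Edge 3 L, ℓ e * ((108 : ℝ)⁻¹) ^ (Finset.univ.sup fun i : Fin 3 => ((e.1 i - e₀.1 i).valMinAbs).natAbs)) (Real.sqrt 2 * Real.pi * Real.exp (-((1 - 12 * |β'|) * (t : ℝ))) * Real.sqrt (∑ e : Edge 3 L, ℓ e ^ 2)) with h | h
  · rw [min_eq_left h]; exact hLR
  · rw [min_eq_right h]; exact hcurv

/-- ★★ **Interpolated space-time profile** (locality WITH decay).  In the setting of `transitionKernel_linkLipschitz_spacetime_profile`, for every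
`θ ∈ [0, 1]`: the Lipschitz constant of `κ_t(f∘coords)` in the link `e₀` is
`≤ (e^(λt)·Σ_e ℓ_e 108^(−D(e,e₀)))^(1−θ) · (√2π·e^(−ρt)·√(Σ_e ℓ_e²))^θ` — e.g. with `ℓ` supported in `Λ` at sup-distance `D` from `e₀` this is
`≤ C·exp(((1−θ)λ − θρ)t − (1−θ)D log 108)`, decaying in time as soon as `θ > λ/(λ+ρ)` and in space as long as `θ < 1`. [folklore] -/
theorem transitionKernel_linkLipschitz_interpolated_profile (L : ℕ) [NeZero L] (β' : ℝ) (hβ : |β'| < 1 / 12)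
    (κ : ℝ≥0 → Kernel (GaugeConfig 3 L (Matrix.specialUnitaryGroup (Fin 2) ℂ))
      (GaugeConfig 3 L (Matrix.specialUnitaryGroup (Fin 2) ℂ))) [∀ t, IsMarkovKernel (κ t)]
    (hreal : ∀ (t : ℝ≥0) (x : GaugeConfig 3 L (Matrix.specialUnitaryGroup (Fin 2) ℂ))
        (Ω : Type) [MeasurableSpace Ω] (P : Measure Ω) [IsProbabilityMeasure P]
        (W : ℝ≥0 → Ω → (Edge 3 L × NoiseIdx 2 → ℝ)) (hW : IsFlatBrownian W P)
        (U : ℝ≥0 → Ω → GaugeConfig 3 L (Matrix.specialUnitaryGroup (Fin 2) ℂ)),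
        (∀ ω, U 0 ω = x) →
        (latticeLangevinDynamics (fundamentalLatticeRep 2) β').IsSolution (fundamentalRep (Fin 2))
          hW.natFiltration P W U →
        κ t x = P.map (U t))
    {f : (Edge 3 L × Fin 2 × Fin 2 × Bool → ℝ) → ℝ} (hf : ContDiff ℝ 5 f) {ℓ : Edge 3 L → ℝ} (hℓ : ∀ e, 0 ≤ ℓ e)
    (t : ℝ≥0) (e₀ : Edge 3 L) (y y' : GaugeConfig 3 L (Matrix.specialUnitaryGroup (Fin 2) ℂ)) (hyy' : ∀ e, e ≠ e₀ → y e = y' e)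
    {θ : ℝ} (hθ0 : 0 ≤ θ) (hθ1 : θ ≤ 1) :
    let coords : GaugeConfig 3 L (Matrix.specialUnitaryGroup (Fin 2) ℂ) → (Edge 3 L × Fin 2 × Fin 2 × Bool → ℝ) :=
      fun V q => (fun z : ℂ => if q.2.2.2 then z.im else z.re)
        ((fundamentalRep (Fin 2) (V q.1) : Matrix (Fin 2) (Fin 2) ℂ) q.2.1 q.2.2.1)
    (∀ (e : Edge 3 L) (y y' : (GaugeConfig 3 L (Matrix.specialUnitaryGroup (Fin 2) ℂ))), (∀ f', f' ≠ e → y f' = y' f') →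
      |f (coords y) - f (coords y')| ≤ ℓ e * frobNorm ((y e : Matrix (Fin 2) (Fin 2) ℂ) - (y' e : Matrix (Fin 2) (Fin 2) ℂ))) →
    |(∫ z, f (coords z) ∂(κ t y)) - ∫ z, f (coords z) ∂(κ t y')| ≤
      (Real.exp ((1300 + 4 * Real.sqrt 2) * |β'| * (t : ℝ)) * ∑ e : Edge 3 L, ℓ e * ((108 : ℝ)⁻¹) ^ (Finset.univ.sup fun i : Fin 3 => ((e.1 i - e₀.1 i).valMinAbs).natAbs)) ^ (1 - θ) * (Real.sqrt 2 * Real.pi * Real.exp (-((1 - 12 * |β'|) * (t : ℝ))) * Real.sqrt (∑ e : Edge 3 L, ℓ e ^ 2)) ^ θ * frobNorm ((y e₀ : Matrix (Fin 2) (Fin 2) ℂ) - (y' e₀ : Matrix (Fin 2) (Fin 2) ℂ)) := by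
  intro coords hLip
  have h := transitionKernel_linkLipschitz_spacetime_profile L β' hβ κ hreal hf hℓ t e₀ y y' hyy' hLip
  refine h.trans (mul_le_mul_of_nonneg_right ?_ (frobNorm_nonneg _))
  have ha : 0 ≤ (Real.exp ((1300 + 4 * Real.sqrt 2) * |β'| * (t : ℝ)) * ∑ e : Edge 3 L, ℓ e * ((108 : ℝ)⁻¹) ^ (Finset.univ.sup fun i : Fin 3 => ((e.1 i - e₀.1 i).valMinAbs).natAbs)) := mul_nonneg (Real.exp_pos _).le (Finset.sum_nonneg fun e _ => mul_nonneg (hℓ e) (by positivity))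
  have hb : 0 ≤ (Real.sqrt 2 * Real.pi * Real.exp (-((1 - 12 * |β'|) * (t : ℝ))) * Real.sqrt (∑ e : Edge 3 L, ℓ e ^ 2)) := by positivity
  -- `min a b ≤ a^(1−θ) b^θ` (as in `Literature.Analysis.FluidPDE.BDSV.min_le_rpow_mul_rpow`, inlined)
  set a : ℝ := (Real.exp ((1300 + 4 * Real.sqrt 2) * |β'| * (t : ℝ)) * ∑ e : Edge 3 L, ℓ e * ((108 : ℝ)⁻¹) ^ (Finset.univ.sup fun i : Fin 3 => ((e.1 i - e₀.1 i).valMinAbs).natAbs)) with hadef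
  set b : ℝ := (Real.sqrt 2 * Real.pi * Real.exp (-((1 - 12 * |β'|) * (t : ℝ))) * Real.sqrt (∑ e : Edge 3 L, ℓ e ^ 2)) with hbdef
  have hm0 : 0 ≤ min a b := le_min ha hb
  have h1 : (min a b) ^ (1 - θ) ≤ a ^ (1 - θ) := Real.rpow_le_rpow hm0 (min_le_left a b) (by linarith)
  have h2 : (min a b) ^ θ ≤ b ^ θ := Real.rpow_le_rpow hm0 (min_le_right a b) hθ0
  calc min a b = (min a b) ^ ((1 - θ) + θ) := by rw [show (1 - θ) + θ = 1 by ring, Real.rpow_one]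
    _ = (min a b) ^ (1 - θ) * (min a b) ^ θ := Real.rpow_add' hm0 (by rw [show (1 - θ) + θ = 1 by ring]; norm_num)
    _ ≤ a ^ (1 - θ) * b ^ θ := mul_le_mul h1 h2 (Real.rpow_nonneg hm0 _) (Real.rpow_nonneg ha _)

end Summit.QuantumFields.YangMills.Theorems.ColdStartUniversality.LiebRobinson
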